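import Summits.BirchSwinnertonDyer.BirchSwinnertonDyer.Theorems.PrintX9HowardContainmentPinnedOfFlachLeafIntended
import Summits.BirchSwinnertonDyer.BirchSwinnertonDyer.Theorems.SchneiderFreeAdditiveX3PoitouTateShaDualityHolds
import Summits.BirchSwinnertonDyer.BirchSwinnertonDyer.Theorems.PoitouTateSelmerStructureDualityConjHolds
import Literature.NumberTheory.GaloisCohomology.Howard2004.TowerZModLeftKernelPairingProofs
import HarnessLib

/-!
# Row 9's A-side from TWO cite-only print leaves — CGLS Thm. 4.1.1 KS form (F-411) and CGS Thm. 6.5.2 — the Howard input (Thm. 1.6.1 via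
# Prop. 1.4.1 / Flach, print-as-intended) being a KERNEL theorem of the cell; display `bsdpOnClassX9_of_fiveLeaves`

Cell `pub/bsd-print-x9`, seat `bsd-line-x9-p1` LEAD g10. `--supports` stmt-BirchSwinnertonDyer-22642 (helper). THEOREMS ONLY.

The cell's C451 swarm discharged C45.1″ in the kernel: `Howard2004.prop141_casselsTate_skewPairing_atLevel_printIntended_of_poitouTate` (bsd-line-x10b-p1
LEAD g14, p729060) modulo `Automorphic.chebotarev_artinRep`, `poitouTate_sha_tateDual`, `poitouTate_selmerStructure_duality_conj` — each a theorem of the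
tree (`chebotarev_artinRep_of_galoisSide`, `SchneiderFreeAdditiveX3.PoitouTateReduction.poitouTate_sha_tateDual_holds`,
`InputsPoitouTateSelmer.poitouTate_selmerStructure_duality_conj_holds`), applied INLINE here — so this seat's DISPLAY-PROP141″-X9
(`PrintX9OfFlachLeafIntended`, p723343) specialises to:
* **`howardContainmentLightFramePinned_of_kolyvaginSystem_cgs : CGLSHeegnerKolyvaginSystem → CGSHowardDivisibilityPLocalized → HowardContainmentLightFramePinned`**
  (item 26356's decl from F-411 and CGS 6.5.2 alone);
* **`bsdpOnClassX9_of_fiveLeaves (hK hCGS hPT hHP hCP hT hμ) : Rank1Residual.BSDpOnClassX9`** — row 9's display from FIVE cite-only print leaves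
  {F-411, CGS 6.5.2, `PinnedTransferPrintFacts`, `HeegnerPrintFactsX9`, `CyclotomicPrintFactsX9`} + the two K6 μ-inputs; NO Howard 2004 leaf remains.
HONEST FRAMING: CONDITIONAL on the leaves named; no item is closed by this file; no route verb is implied. «beyond-print theorem»: no.
No summit statement is proved; F-411 / CGS 6.5.2 are not proved; BSD is NOT proved by any of this.

References: [Howard2004HeegnerKolyvagin] Prop. 1.4.1, Thm. 1.4.2, Thm. 1.6.1 (kernel); [CastellaGrossiLeeSkinner2022] Thm. 4.1.1, Rem. 4.1.4;
[CastellaGrossiSkinner2025] Thm. 6.5.2.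
-/

set_option linter.dupNamespace false
set_option autoImplicit false

noncomputable section

open Literature.NumberTheory.GaloisCohomology Literature.NumberTheory.GaloisCohomology.Howard2004
open Summit.BirchSwinnertonDyer.BirchSwinnertonDyer.Theses.PrintX9
open Summit.BirchSwinnertonDyer.BirchSwinnertonDyer.Theorems

namespace Summit.BirchSwinnertonDyer.BirchSwinnertonDyer.Theorems.PrintX9OfTwoLeaves

/-- **`HowardContainmentLightFramePinned` (stmt-BirchSwinnertonDyer-26356) from CGLS Thm. 4.1.1 KS form (F-411) and CGS Thm. 6.5.2 ALONE** —
`PrintX9OfFlachLeafIntended.howardContainmentLightFramePinned_of_prop141Intended_kolyvaginSystem_cgs` at the kernel theorem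
`Howard2004.prop141_casselsTate_skewPairing_atLevel_printIntended_of_poitouTate` (bsd-line-x10b-p1 LEAD g14, p729060) fed with the tree's
`Automorphic.chebotarev_artinRep_of_galoisSide`, `SchneiderFreeAdditiveX3.PoitouTateReduction.poitouTate_sha_tateDual_holds`, `InputsPoitouTateSelmer.poitouTate_selmerStructure_duality_conj_holds`. CONDITIONAL on the two leaves.
[cite: CastellaGrossiLeeSkinner2022, Thm. 4.1.1, Rem. 4.1.4] [cite: CastellaGrossiSkinner2025, Thm. 6.5.2] [cite: Howard2004HeegnerKolyvagin, Thm. 1.6.1] -/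
theorem howardContainmentLightFramePinned_of_kolyvaginSystem_cgs :
    CGLSHeegnerKolyvaginSystem → CGSHowardDivisibilityPLocalized → HowardContainmentLightFramePinned :=
  PrintX9OfFlachLeafIntended.howardContainmentLightFramePinned_of_prop141Intended_kolyvaginSystem_cgs
    (prop141_casselsTate_skewPairing_atLevel_printIntended_of_poitouTate
      Literature.NumberTheory.Automorphic.chebotarev_artinRep_of_galoisSide
      (fun K _ _ => SchneiderFreeAdditiveX3.PoitouTateReduction.poitouTate_sha_tateDual_holds K)
      (fun K _ _ => InputsPoitouTateSelmer.poitouTate_selmerStructure_duality_conj_holds K))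

/-- **The deciding crux decl shape `HowardContainmentLightFramePinnedOfPrintSharp` (27077: `hMZ → hNV → hCGS → hTw♯ → A^pin`) from F-411 alone,
`hMZ`, `hNV`, `hTw♯` idle** — for the pen. [cite: CastellaGrossiLeeSkinner2022, Thm. 4.1.1] [cite: CastellaGrossiSkinner2025, Thm. 6.5.2] -/
theorem howardContainmentLightFramePinnedOfPrintSharp_of_kolyvaginSystem :
    CGLSHeegnerKolyvaginSystem → HowardContainmentLightFramePinnedOfPrintSharp :=
  fun hKS _hMZ _hNV hCGS _hTw ↦ howardContainmentLightFramePinned_of_kolyvaginSystem_cgs hKS hCGS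

/-- **DISPLAY — `BSD_p` on the X9 leaf from FIVE cite-only print leaves and the two K6 μ-inputs, with NO Howard 2004 leaf**: CGLS 2022 Thm. 4.1.1
KS form (F-411), CGS 2025 Thm. 6.5.2, `PinnedTransferPrintFacts`, `HeegnerPrintFactsX9`, `CyclotomicPrintFactsX9`, and `MuTransfer` / `AnalyticMuZeroX9`
(items 19629 / 19630) — `PrintX9OfFlachLeafIntended.bsdpOnClassX9_of_sixLeaves_prop141Intended` at the kernel C45.1″. CONDITIONAL on the seven hypotheses;
a display, not a closure. [cite: CastellaGrossiLeeSkinner2022, Thm. 4.1.1, Rem. 4.1.4] [cite: CastellaGrossiSkinner2025, Thm. 6.5.2]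
[cite: Howard2004HeegnerKolyvagin, Thm. 1.6.1, Thm. B] -/
theorem bsdpOnClassX9_of_fiveLeaves
    (hK : CGLSHeegnerKolyvaginSystem) (hCGS : CGSHowardDivisibilityPLocalized)
    (hPT : PinnedTransferPrintFacts) (hHP : HeegnerPrintFactsX9) (hCP : CyclotomicPrintFactsX9)
    (hT : MuTransfer) (hμ : AnalyticMuZeroX9) :
    Summit.BirchSwinnertonDyer.BirchSwinnertonDyer.Rank1Residual.BSDpOnClassX9 :=
  PrintX9OfFlachLeafIntended.bsdpOnClassX9_of_sixLeaves_prop141Intended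
    (prop141_casselsTate_skewPairing_atLevel_printIntended_of_poitouTate
      Literature.NumberTheory.Automorphic.chebotarev_artinRep_of_galoisSide
      (fun K _ _ => SchneiderFreeAdditiveX3.PoitouTateReduction.poitouTate_sha_tateDual_holds K)
      (fun K _ _ => InputsPoitouTateSelmer.poitouTate_selmerStructure_duality_conj_holds K)) hK hCGS hPT hHP hCP hT hμ

end Summit.BirchSwinnertonDyer.BirchSwinnertonDyer.Theorems.PrintX9OfTwoLeaves

end
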